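/-
Copyright (c) 2026. All rights reserved.
Released under Apache 2.0 license as described in the file LICENSE.
-/
import Literature.Probability.FitznerVanDerHofstad2017.NobleBoundsNFirstECut
import Literature.Probability.FitznerVanDerHofstad2017.NobleBoundsNMidEProper
import HarnessLib

/-!
# Fitzner–van der Hofstad (2017), §6.1 (6.4) / (5.4) / App. B Table `B^{(2),ι,a,b}`: the FIRST junction, variant `F″` proper, inner class `2` — the rows `(0, ≥2 | d ≥ 2)` and `(≥2, ≥2 | d ≥ 2)` behind the start letter

[FvdH17] = R. Fitzner, R. van der Hofstad, *Mean-field behavior for nearest-neighbor percolation in `d > 10`*,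
arXiv:1506.07977v2 (EJP 22 (2017), paper 43).  Page numbers refer to the arXiv version.

The first-junction copy of `NobleBoundsNMidEProper`: junction `k = 0`, lower level = the start level ((4.57)),
upper level `1` of kind `midE` with `t_0 ≠ u_1` (`F″`) and a genuine last sausage of inner class `2`; exit class
above `a_1 = 2` (clause (8)).  Targets (TERM 3 of (5.4), p. 48, base-`u` reading `NobleBlocksNTPrime.blockBNTpt₀'`
of App. B Table p. 76 — DIVERGENCE D76 of the b2b-lace packet —, `c = 2` summands, behind the start triangle
(5.1)–(5.3)):

* row `(0, ≥2 | d ≥ 2)`: `P^{S,0}(u_0,w_0) · (S_{≥1,≥0,1̲,≥1}(w_1−t_0, b̄_0−t_0, u_0−t_0, z_0−t_0) · T_{≥2,≥1,≥1}(z_0−t_0, u_1−t_0, 0))`;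
* row `(≥2, ≥2 | d ≥ 2)`: `P^{S,2}(u_0,w_0) · (B_{≥1,≥1}(u_1−t_0, z_0−t_0) · P_{1̲,≥0,≥1,≥2,≥0}(b̄_0−u_0, w_1−u_0, t_0−u_0, z_0−u_0, w_0−u_0))`.

The start letter is `NobleBoundsNFirstSOpen.first_startLetter_gl`; the square/triangle rows use the grouping
`glFirstS3`, the pentagon/bubble rows the new grouping `glFirstP`; the row inequalities are the chain letters of
`NoblePercLettersTransportK`.  The row `(1, ≥2 | d ≥ 2)` and the `d = 1` rows are not in this module (bond refunds;
see the lit-g19 design note in the b2b-lace LEMMAS file).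

Conventions: `d`-generic; nothing is cited as a fact; additive (no existing declaration is changed).  The
junction is written `(0 : Fin (M+1)).castSucc`, level `1` as `(0 : Fin (M+1)).succ`.
-/

noncomputable section

namespace Literature.Probability.FitznerVanDerHofstad2017

open Literature.Barriers.CriticalPhenomena Literature.Probability.Percolation
open Literature.Probability.LatticeModels Literature.Combinatorics.SimpleGraph _root_.SimpleGraph
open _root_.MeasureTheory
open Literature.Probability.FitznerVanDerHofstad2017.NobleBlocks
open Literature.Probability.FitznerVanDerHofstad2017.NobleBlocks.LenIdx
open scoped ENNReal

variable {d : ℕ}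

/-! ### A. The pentagon grouping of the first junction and the readings -/

/-- The GROUPING of the first-junction `F″`-proper rows with a pentagon: letter `lo 0` = the start slots,
letter `xb` = {bond, `lo 3`, `up 0`, `up 1`, `up 2`} (`P_{1̲,≥0,≥1,≥2,≥0}`), letter `up 3` = {`up 3`, `up 4`} (bubble).
[cite: FitznerVanDerHofstad2017, App. B Table "B^{(2),ι,a,b}", row a ≥ 2, b ≥ 2, d ≥ 2 (arXiv:1506.07977v2 p. 76); §5.1 (5.1)–(5.4) (pp. 46–48)] -/
def glFirstP : JIdx → JIdx
  | .xb => .xb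
  | .xtz => .xtz
  | .lo j => ![JIdx.lo 0, .lo 0, .lo 0, .xb, .xb, .xb] j
  | .up j => ![JIdx.xb, .xb, .xb, .up 3, .up 3, .up 5] j

section Grouping

variable (M : ℕ) (x : Site d) (b : Fin (M + 2) → Site d × Site d) (w t z : Fin (M + 2) → Site d)
  (a : Fin (M + 2) → Fin 3 ⊕ Unit) (τ : Fin (M + 1) → Bool × Fin 3)

/-- **The grouping `glFirstP` obeys the (4.65) rule over a `midE` level `1`**: its cross-level letter joins start
lines with the ENTRY slots `0, 1, 2` of level `1`.
[cite: FitznerVanDerHofstad2017, §4.4 (4.65) and the sentence after it (arXiv:1506.07977v2 p. 43)] -/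
theorem glFirstP_entry_midE (hσ : (τ 0).1 = true) {a' : Fin 3} (ha' : a (0 : Fin (M + 1)).succ = Sum.inl a')
    (j j' : Fin 6) (hg : glFirstP (.lo j) = glFirstP (.up j')) :
    IsEntry (pieceViews M x b w t z a τ (0 : Fin (M + 1)).castSucc.succ).kd j' := by
  rw [pieceViews_mid_kd, ha', hσ]
  show (j' : ℕ) < 3
  fin_cases j' <;> fin_cases j <;> simp [glFirstP] at hg ⊢

end Grouping

section Letter

variable (p : unitInterval) (M : ℕ) (x : Site d) (b : Fin (M + 2) → Site d × Site d) (w t z : Fin (M + 2) → Site d)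
  (a : Fin (M + 2) → Fin 3 ⊕ Unit) (τ : Fin (M + 1) → Bool × Fin 3)

/-- **Five-line reading of the pentagon letter `xb`** under `glFirstP`: bond (level `0`), `b̄_0 → w_1`, `w_1 → t_0`,
`t_0 ⇒ z_0` (level `1`), the exit line of the start level (slot `3`).
[cite: FitznerVanDerHofstad2017, §4.2 (4.18) (arXiv:1506.07977v2 p. 35); App. B Table "B^{(2),ι,a,b}" (p. 76)] -/
theorem junF_firstEP_xb_le₅ (hσ : (τ 0).1 = true) {a' : Fin 3} (ha' : a (0 : Fin (M + 1)).succ = Sum.inl a')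
    (EB X0 X1 X2 X3 E0 E1 E2 E3 E4 : Set (BondConfig (Site d))) :
    junF p M x b w t z a τ (0 : Fin (M + 1)).castSucc glFirstP true false (firstEvS EB X0 X1 X2 X3 E0 E1 E2 E3 E4)
        .xb ≤
      piPerc d p 2 (genDisjOcc ![EB, E0, E1, E2, X3] ![0, 1, 1, 1, 0]) := by
  refine junF_le_of_lines p M x b w t z a τ (0 : Fin (M + 1)).castSucc glFirstP true false _ JIdx.xb
    ![JIdx.xb, .up 0, .up 1, .up 2, .lo 3] (by decide) (fun m => ?_) ![0, 1, 1, 1, 0]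
    (fun m => by fin_cases m <;> rfl) ![EB, E0, E1, E2, X3] (by funext m; fin_cases m <;> rfl)
  fin_cases m
  · exact ⟨rfl, rfl⟩
  · exact ⟨(jMidE_act_up_iff M x b w t z a τ 0 hσ ha' true false 0).2 (by decide), rfl⟩
  · exact ⟨(jMidE_act_up_iff M x b w t z a τ 0 hσ ha' true false 1).2 (by decide), rfl⟩
  · exact ⟨(jMidE_act_up_iff M x b w t z a τ 0 hσ ha' true false 2).2 (by decide), rfl⟩
  · exact ⟨(jFirst_act_lo_iff M x b w t z a τ true false 3).2 (by decide), rfl⟩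

/-- **Two-line reading of the bubble letter `up 3`** under `glFirstP`: `t_0 → u_1`, `u_1 → z_0`.
[cite: FitznerVanDerHofstad2017, §4.2 (4.16) (arXiv:1506.07977v2 p. 36); App. B (p. 76)] -/
theorem junF_firstEP_up_le₂ (hσ : (τ 0).1 = true) {a' : Fin 3} (ha' : a (0 : Fin (M + 1)).succ = Sum.inl a')
    (EB X0 X1 X2 X3 E0 E1 E2 E3 E4 : Set (BondConfig (Site d))) :
    junF p M x b w t z a τ (0 : Fin (M + 1)).castSucc glFirstP true false (firstEvS EB X0 X1 X2 X3 E0 E1 E2 E3 E4)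
        (.up 3) ≤
      piPerc d p 2 (genDisjOcc ![E3, E4] ![1, 1]) := by
  refine junF_le_of_lines p M x b w t z a τ (0 : Fin (M + 1)).castSucc glFirstP true false _ (JIdx.up 3)
    ![JIdx.up 3, .up 4] (by decide) (fun m => ?_) ![1, 1] (fun m => by fin_cases m <;> rfl)
    ![E3, E4] (by funext m; fin_cases m <;> rfl)
  fin_cases m
  · exact ⟨(jMidE_act_up_iff M x b w t z a τ 0 hσ ha' true false 3).2 (by decide), rfl⟩
  · exact ⟨(jMidE_act_up_iff M x b w t z a τ 0 hσ ha' true false 4).2 (by decide), rfl⟩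

/-- **Four-line reading of the square letter `xb`** under `glFirstS3` over a `midE` level `1`, in the order of the
printed square: `w_1 → t_0` reversed (slot `1`), `b̄_0 → w_1` reversed (slot `0`), bond, exit line of the start level.
[cite: FitznerVanDerHofstad2017, §4.2 (4.18) (arXiv:1506.07977v2 p. 35); App. B Table "B^{(2),ι,a,b}" row a = 0 (p. 76)] -/
theorem junF_firstES_xb_le₄ (hσ : (τ 0).1 = true) {a' : Fin 3} (ha' : a (0 : Fin (M + 1)).succ = Sum.inl a')
    (EB X0 X1 X2 X3 E0 E1 E2 E3 E4 : Set (BondConfig (Site d))) :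
    junF p M x b w t z a τ (0 : Fin (M + 1)).castSucc glFirstS3 true false (firstEvS EB X0 X1 X2 X3 E0 E1 E2 E3 E4)
        .xb ≤
      piPerc d p 2 (genDisjOcc ![E1, E0, EB, X3] ![1, 1, 0, 0]) := by
  refine junF_le_of_lines p M x b w t z a τ (0 : Fin (M + 1)).castSucc glFirstS3 true false _ JIdx.xb
    ![JIdx.up 1, .up 0, .xb, .lo 3] (by decide) (fun m => ?_) ![1, 1, 0, 0] (fun m => by fin_cases m <;> rfl)
    ![E1, E0, EB, X3] (by funext m; fin_cases m <;> rfl)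
  fin_cases m
  · exact ⟨(jMidE_act_up_iff M x b w t z a τ 0 hσ ha' true false 1).2 (by decide), rfl⟩
  · exact ⟨(jMidE_act_up_iff M x b w t z a τ 0 hσ ha' true false 0).2 (by decide), rfl⟩
  · exact ⟨rfl, rfl⟩
  · exact ⟨(jFirst_act_lo_iff M x b w t z a τ true false 3).2 (by decide), rfl⟩

/-- **Three-line reading of the triangle letter `up 2`** under `glFirstS3` over a `midE` level `1`: `t_0 ⇒ z_0`
(slot `2`), `z_0 → u_1` (slot `4`), `u_1 → t_0` (slot `3`, read backwards).
[cite: FitznerVanDerHofstad2017, §4.2 (4.17) (arXiv:1506.07977v2 p. 36); App. B (p. 76)] -/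
theorem junF_firstES_up_le₃ (hσ : (τ 0).1 = true) {a' : Fin 3} (ha' : a (0 : Fin (M + 1)).succ = Sum.inl a')
    (EB X0 X1 X2 X3 E0 E1 E2 E3 E4 : Set (BondConfig (Site d))) :
    junF p M x b w t z a τ (0 : Fin (M + 1)).castSucc glFirstS3 true false (firstEvS EB X0 X1 X2 X3 E0 E1 E2 E3 E4)
        (.up 2) ≤
      piPerc d p 2 (genDisjOcc ![E2, E4, E3] ![1, 1, 1]) := by
  refine junF_le_of_lines p M x b w t z a τ (0 : Fin (M + 1)).castSucc glFirstS3 true false _ (JIdx.up 2)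
    ![JIdx.up 2, .up 4, .up 3] (by decide) (fun m => ?_) ![1, 1, 1] (fun m => by fin_cases m <;> rfl)
    ![E2, E4, E3] (by funext m; fin_cases m <;> rfl)
  fin_cases m
  · exact ⟨(jMidE_act_up_iff M x b w t z a τ 0 hσ ha' true false 2).2 (by decide), rfl⟩
  · exact ⟨(jMidE_act_up_iff M x b w t z a τ 0 hσ ha' true false 4).2 (by decide), rfl⟩
  · exact ⟨(jMidE_act_up_iff M x b w t z a τ 0 hσ ha' true false 3).2 (by decide), rfl⟩

end Letter

/-! ### B. The parameter facts -/

section ProperFacts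

variable {M : ℕ} {x : Site d} {b : Fin (M + 2) → Site d × Site d} {w t z : Fin (M + 2) → Site d}
  {a : Fin (M + 2) → Fin 3 ⊕ Unit} {c : Fin 3 ⊕ Unit} {τ : Fin (M + 1) → Bool × Fin 3}
  {ω : Fin (M + 3) → BondConfig (Site d)} {K₀ : Fin (M + 3) → Fin 6 → Set (Sym2 (Site d))}

variable (M x b w t z a c τ) in
/-- The PARAMETER FACTS of a non-empty first-junction `F″`-proper piece of inner class `2`: those of
`firstECut_facts` together with `t_0 ≠ z_0` and the closed sausage bond.
[cite: FitznerVanDerHofstad2017, (4.57)–(4.60), (4.64) and §6.1 "Case b ≥ 2" (arXiv:1506.07977v2 pp. 41–42, 58–59)] -/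
theorem firstEProper_facts (hF : JFacts M x b w t z a c τ ω K₀) (hσ : (τ 0).1 = true) {a₀ a' : Fin 3}
    (ha : a (0 : Fin (M + 1)).castSucc = Sum.inl a₀) (ha' : a (0 : Fin (M + 1)).succ = Sum.inl a')
    (hty : t (0 : Fin (M + 1)).castSucc ≠ (b (0 : Fin (M + 1)).succ).1) (hc2 : (τ 0).2 = 2) :
    (a' = 2 ∧ z (0 : Fin (M + 1)).castSucc ≠ (b (0 : Fin (M + 1)).succ).1 ∧
      w (0 : Fin (M + 1)).succ ≠ t (0 : Fin (M + 1)).castSucc ∧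
      (b (0 : Fin (M + 1)).castSucc).1 ≠ t (0 : Fin (M + 1)).castSucc ∧
      (b (0 : Fin (M + 1)).castSucc).1 ≠ w (0 : Fin (M + 1)).succ ∧
      (b (0 : Fin (M + 1)).castSucc).1 ≠ z (0 : Fin (M + 1)).castSucc ∧
      (b (0 : Fin (M + 1)).castSucc).2 ≠ z (0 : Fin (M + 1)).castSucc ∧
      ((b (0 : Fin (M + 1)).castSucc).1 = 0 → w (0 : Fin (M + 1)).castSucc = 0) ∧
      (a₀ = 0 → w (0 : Fin (M + 1)).castSucc = (b (0 : Fin (M + 1)).castSucc).1) ∧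
      (a₀ = 1 → (zdGraph d).Adj (b (0 : Fin (M + 1)).castSucc).1 (w (0 : Fin (M + 1)).castSucc)) ∧
      (a₀ = 2 → (b (0 : Fin (M + 1)).castSucc).1 ≠ w (0 : Fin (M + 1)).castSucc)) ∧
    t (0 : Fin (M + 1)).castSucc ≠ z (0 : Fin (M + 1)).castSucc ∧
    s(t (0 : Fin (M + 1)).castSucc, z (0 : Fin (M + 1)).castSucc) ∉ ω (0 : Fin (M + 1)).castSucc.succ :=
  ⟨firstECut_facts M x b w t z a c τ hF hσ ha ha' hty, hF.t_ne_z_of_innerClass_ne_zero 0 (by rw [hc2]; decide),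
    (hF.innerClass_two 0 hc2).2⟩

end ProperFacts

/-! ### C. The cores -/

section Packages

variable (p : unitInterval) (M : ℕ) (x : Site d) (b : Fin (M + 2) → Site d × Site d) (w t z : Fin (M + 2) → Site d)
  (a : Fin (M + 2) → Fin 3 ⊕ Unit) (c : Fin 3 ⊕ Unit) (τ : Fin (M + 1) → Bool × Fin 3)

/-- **Core, pentagon grouping of the first junction**: start-letter data, events for the exit line of the start
level and all five lines of level `1`, a bond event `EB ∋ {b_0}`, and bounds of the letters `lo 0 ≤ T₀`, `xb ≤ T₁`,
`up 3 ≤ T₂` give a package with target `T₀ * (T₁ * T₂)`.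
[cite: FitznerVanDerHofstad2017, §6.1 (6.4) (arXiv:1506.07977v2 p. 58); §4.4 (4.57)–(4.60), (4.65) (pp. 41, 43)] -/
theorem nonempty_jPkg_firstEP_core (hσ : (τ 0).1 = true) {a' : Fin 3} (ha' : a (0 : Fin (M + 1)).succ = Sum.inl a')
    (EB X0 X1 X2 X3 E0 E1 E2 E3 E4 : Set (BondConfig (Site d))) (hfB : IsFinitary EB) (f0 : IsFinitary X0)
    (f1 : IsFinitary X1) (f2 : IsFinitary X2) (f3 : IsFinitary X3) (h0 : IsFinitary E0) (h1 : IsFinitary E1)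
    (h2 : IsFinitary E2) (h3 : IsFinitary E3) (h4 : IsFinitary E4)
    (hB : ({s((b (0 : Fin (M + 1)).castSucc).1, (b (0 : Fin (M + 1)).castSucc).2)} : Set (Sym2 (Site d))) ∈ EB)
    (hmem : ∀ ω K₀, JFacts M x b w t z a c τ ω K₀ →
      K₀ (0 : Fin (M + 1)).castSucc.castSucc 0 ∈ X0 ∧ K₀ (0 : Fin (M + 1)).castSucc.castSucc 1 ∈ X1 ∧
        K₀ (0 : Fin (M + 1)).castSucc.castSucc 2 ∈ X2 ∧ K₀ (0 : Fin (M + 1)).castSucc.castSucc 3 ∈ X3 ∧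
        K₀ (0 : Fin (M + 1)).castSucc.succ 0 ∈ E0 ∧ K₀ (0 : Fin (M + 1)).castSucc.succ 1 ∈ E1 ∧
        K₀ (0 : Fin (M + 1)).castSucc.succ 2 ∈ E2 ∧ K₀ (0 : Fin (M + 1)).castSucc.succ 3 ∈ E3 ∧
        K₀ (0 : Fin (M + 1)).castSucc.succ 4 ∈ E4)
    {T₀ T₁ T₂ : ℝ≥0∞}
    (hrow₀ : junF p M x b w t z a τ (0 : Fin (M + 1)).castSucc glFirstP true false
      (firstEvS EB X0 X1 X2 X3 E0 E1 E2 E3 E4) (.lo 0) ≤ T₀)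
    (hrow₁ : junF p M x b w t z a τ (0 : Fin (M + 1)).castSucc glFirstP true false
      (firstEvS EB X0 X1 X2 X3 E0 E1 E2 E3 E4) .xb ≤ T₁)
    (hrow₂ : junF p M x b w t z a τ (0 : Fin (M + 1)).castSucc glFirstP true false
      (firstEvS EB X0 X1 X2 X3 E0 E1 E2 E3 E4) (.up 3) ≤ T₂) :
    Nonempty (JPkg p (jctx M x b w t z a τ (0 : Fin (M + 1)).castSucc) (JFacts M x b w t z a c τ)
      (T₀ * (T₁ * T₂))) := by
  rw [← mul_assoc]
  refine nonempty_jPkg_of_joint p (0 : Fin (M + 1)).castSucc glFirstP true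
    (firstEvS EB X0 X1 X2 X3 E0 E1 E2 E3 E4)
    (isFinitary_firstEvS _ _ _ _ _ _ _ _ _ _ hfB f0 f1 f2 f3 h0 h1 h2 h3 h4)
    (fun _ => by rw [firstEvS_xb]; exact hB)
    (fun j j' _ _ hg => glFirstP_entry_midE M x b w t z a τ hσ ha' j j' hg)
    (fun ω K₀ hF => ⟨fun j hj => ?_, fun j hj => ?_⟩) ?_
  · have hj4 : (j : ℕ) < 4 := (jFirst_act_lo_iff M x b w t z a τ true false j).1 hj
    obtain ⟨m0, m1, m2, m3, -⟩ := hmem ω K₀ hF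
    exact mem_firstEvS_lo _ _ _ _ _ _ _ _ _ _ m0 m1 m2 m3 j hj4
  · have hj5 : j ≠ 5 := (jMidE_act_up_iff M x b w t z a τ 0 hσ ha' true false j).1 hj
    obtain ⟨-, -, -, -, m0, m1, m2, m3, m4⟩ := hmem ω K₀ hF
    exact mem_firstEvS_up _ _ _ _ _ _ _ _ _ _ m0 m1 m2 m3 m4 j hj5
  · exact (prod_junF_le₃ p M x b w t z a τ (0 : Fin (M + 1)).castSucc glFirstP true false _
      (show JIdx.lo 0 ≠ JIdx.xb by decide) (show JIdx.lo 0 ≠ JIdx.up 3 by decide)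
      (show JIdx.xb ≠ JIdx.up 3 by decide)).trans (mul_le_mul' (mul_le_mul' hrow₀ hrow₁) hrow₂)

/-- **Core, square/triangle grouping of the first junction** (`glFirstS3` over a `midE` level `1`, all five upper
lines read, bond event as a hypothesis): target `T₀ * (T₁ * T₂)`.
[cite: FitznerVanDerHofstad2017, §6.1 (6.4) (arXiv:1506.07977v2 p. 58); §4.4 (4.57)–(4.60), (4.65) (pp. 41, 43)] -/
theorem nonempty_jPkg_firstES_core (hσ : (τ 0).1 = true) {a' : Fin 3} (ha' : a (0 : Fin (M + 1)).succ = Sum.inl a')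
    (EB X0 X1 X2 X3 E0 E1 E2 E3 E4 : Set (BondConfig (Site d))) (hfB : IsFinitary EB) (f0 : IsFinitary X0)
    (f1 : IsFinitary X1) (f2 : IsFinitary X2) (f3 : IsFinitary X3) (h0 : IsFinitary E0) (h1 : IsFinitary E1)
    (h2 : IsFinitary E2) (h3 : IsFinitary E3) (h4 : IsFinitary E4)
    (hB : ({s((b (0 : Fin (M + 1)).castSucc).1, (b (0 : Fin (M + 1)).castSucc).2)} : Set (Sym2 (Site d))) ∈ EB)
    (hmem : ∀ ω K₀, JFacts M x b w t z a c τ ω K₀ →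
      K₀ (0 : Fin (M + 1)).castSucc.castSucc 0 ∈ X0 ∧ K₀ (0 : Fin (M + 1)).castSucc.castSucc 1 ∈ X1 ∧
        K₀ (0 : Fin (M + 1)).castSucc.castSucc 2 ∈ X2 ∧ K₀ (0 : Fin (M + 1)).castSucc.castSucc 3 ∈ X3 ∧
        K₀ (0 : Fin (M + 1)).castSucc.succ 0 ∈ E0 ∧ K₀ (0 : Fin (M + 1)).castSucc.succ 1 ∈ E1 ∧
        K₀ (0 : Fin (M + 1)).castSucc.succ 2 ∈ E2 ∧ K₀ (0 : Fin (M + 1)).castSucc.succ 3 ∈ E3 ∧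
        K₀ (0 : Fin (M + 1)).castSucc.succ 4 ∈ E4)
    {T₀ T₁ T₂ : ℝ≥0∞}
    (hrow₀ : junF p M x b w t z a τ (0 : Fin (M + 1)).castSucc glFirstS3 true false
      (firstEvS EB X0 X1 X2 X3 E0 E1 E2 E3 E4) (.lo 0) ≤ T₀)
    (hrow₁ : junF p M x b w t z a τ (0 : Fin (M + 1)).castSucc glFirstS3 true false
      (firstEvS EB X0 X1 X2 X3 E0 E1 E2 E3 E4) .xb ≤ T₁)
    (hrow₂ : junF p M x b w t z a τ (0 : Fin (M + 1)).castSucc glFirstS3 true false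
      (firstEvS EB X0 X1 X2 X3 E0 E1 E2 E3 E4) (.up 2) ≤ T₂) :
    Nonempty (JPkg p (jctx M x b w t z a τ (0 : Fin (M + 1)).castSucc) (JFacts M x b w t z a c τ)
      (T₀ * (T₁ * T₂))) := by
  rw [← mul_assoc]
  refine nonempty_jPkg_of_joint p (0 : Fin (M + 1)).castSucc glFirstS3 true
    (firstEvS EB X0 X1 X2 X3 E0 E1 E2 E3 E4)
    (isFinitary_firstEvS _ _ _ _ _ _ _ _ _ _ hfB f0 f1 f2 f3 h0 h1 h2 h3 h4)
    (fun _ => by rw [firstEvS_xb]; exact hB)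
    (fun j j' _ _ hg => glFirstS3_entry_midE M x b w t z a τ hσ ha' j j' hg)
    (fun ω K₀ hF => ⟨fun j hj => ?_, fun j hj => ?_⟩) ?_
  · have hj4 : (j : ℕ) < 4 := (jFirst_act_lo_iff M x b w t z a τ true false j).1 hj
    obtain ⟨m0, m1, m2, m3, -⟩ := hmem ω K₀ hF
    exact mem_firstEvS_lo _ _ _ _ _ _ _ _ _ _ m0 m1 m2 m3 j hj4
  · have hj5 : j ≠ 5 := (jMidE_act_up_iff M x b w t z a τ 0 hσ ha' true false j).1 hj
    obtain ⟨-, -, -, -, m0, m1, m2, m3, m4⟩ := hmem ω K₀ hF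
    exact mem_firstEvS_up _ _ _ _ _ _ _ _ _ _ m0 m1 m2 m3 m4 j hj5
  · exact (prod_junF_le₃ p M x b w t z a τ (0 : Fin (M + 1)).castSucc glFirstS3 true false _
      (show JIdx.lo 0 ≠ JIdx.xb by decide) (show JIdx.lo 0 ≠ JIdx.up 2 by decide)
      (show JIdx.xb ≠ JIdx.up 2 by decide)).trans (mul_le_mul' (mul_le_mul' hrow₀ hrow₁) hrow₂)

/-! ### D. The cells -/

/-- **Row `(≥2, ≥2 | d ≥ 2)` of `B^{(2)}` at the FIRST junction behind `P^{S,2}`**: for `t_0 ≠ u_1` (`F″`), inner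
class `2`, start class `2`, a package with target
`P^{S,2}(u_0,w_0) · (B_{≥1,≥1}(u_1−t_0, z_0−t_0) · P_{1̲,≥0,≥1,≥2,≥0}(b̄_0−u_0, w_1−u_0, t_0−u_0, z_0−u_0, w_0−u_0))`;
`a_1 ≤ 1`: empty piece.
[cite: FitznerVanDerHofstad2017, App. B Table "B^{(2),ι,a,b}", row a ≥ 2, b ≥ 2, d ≥ 2 (arXiv:1506.07977v2 p. 76); §5.1 (5.3)–(5.4) (pp. 46–48); §6.1 "Case a ≥ 2" (p. 59)] -/
theorem nonempty_jPkg_firstE_proper_two_two (κ : Fin d × Bool)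
    (hb : (b (0 : Fin (M + 1)).castSucc).2 = (b (0 : Fin (M + 1)).castSucc).1 + stepVec κ) (hσ : (τ 0).1 = true)
    (hc2 : (τ 0).2 = 2) (ha : a (0 : Fin (M + 1)).castSucc = Sum.inl 2) {a' : Fin 3}
    (ha' : a (0 : Fin (M + 1)).succ = Sum.inl a') (hty : t (0 : Fin (M + 1)).castSucc ≠ (b (0 : Fin (M + 1)).succ).1) :
    Nonempty (JPkg p (jctx M x b w t z a τ (0 : Fin (M + 1)).castSucc) (JFacts M x b w t z a c τ)
      (blockPS (Letters.perc d p) 2 (b (0 : Fin (M + 1)).castSucc).1 (w (0 : Fin (M + 1)).castSucc) *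
        ((Letters.perc d p).B (ge 1) (ge 1) ((b (0 : Fin (M + 1)).succ).1 - t (0 : Fin (M + 1)).castSucc)
            (z (0 : Fin (M + 1)).castSucc - t (0 : Fin (M + 1)).castSucc) *
          (Letters.perc d p).P (eq 1) (ge 0) (ge 1) (ge 2) (ge 0)
            ((b (0 : Fin (M + 1)).castSucc).2 - (b (0 : Fin (M + 1)).castSucc).1)
            (w (0 : Fin (M + 1)).succ - (b (0 : Fin (M + 1)).castSucc).1)
            (t (0 : Fin (M + 1)).castSucc - (b (0 : Fin (M + 1)).castSucc).1)
            (z (0 : Fin (M + 1)).castSucc - (b (0 : Fin (M + 1)).castSucc).1)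
            (w (0 : Fin (M + 1)).castSucc - (b (0 : Fin (M + 1)).castSucc).1)))) := by
  -- exit class `a′ ≤ 1` above: the piece is empty (clause (8))
  by_cases h2 : a' = 2
  swap
  · exact nonempty_jPkg_of_sharp p c _ 0 hσ ha' h2 hty _
  subst h2
  -- degenerate parameters: the piece is empty
  by_cases hP : z (0 : Fin (M + 1)).castSucc ≠ (b (0 : Fin (M + 1)).succ).1 ∧
      w (0 : Fin (M + 1)).succ ≠ t (0 : Fin (M + 1)).castSucc ∧
      t (0 : Fin (M + 1)).castSucc ≠ z (0 : Fin (M + 1)).castSucc ∧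
      ((b (0 : Fin (M + 1)).castSucc).1 = 0 → w (0 : Fin (M + 1)).castSucc = 0) ∧
      (b (0 : Fin (M + 1)).castSucc).1 ≠ w (0 : Fin (M + 1)).castSucc
  swap
  · refine ⟨JPkg.vacuous p _ _ (fun ω K₀ hF => hP ?_) _⟩
    obtain ⟨⟨-, hzy, hwt, -, -, -, -, hcan, -, -, hw2⟩, htz, -⟩ := firstEProper_facts M x b w t z a c τ hF hσ ha ha' hty hc2
    exact ⟨hzy, hwt, htz, hcan, hw2 rfl⟩
  obtain ⟨hzy, hwt, htz, hcan, huw⟩ := hP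
  have huv : (b (0 : Fin (M + 1)).castSucc).1 ≠ (b (0 : Fin (M + 1)).castSucc).2 := by
    rw [hb]; exact (zdGraph_adj_iff_stepVec _ _ |>.2 ⟨κ, rfl⟩).ne
  obtain ⟨X0, X1, X2, f0, f1, f2, hmem₀, hrow₀⟩ :=
    first_startLetter_gl p M x b w t z a c τ glFirstP true false (.lo 0) rfl rfl rfl ha hcan
      (fun h => absurd h (by decide)) (fun h => absurd h (by decide)) (fun _ => huw)
  rw [mul_comm ((Letters.perc d p).B _ _ _ _)]
  refine nonempty_jPkg_firstEP_core p M x b w t z a c τ hσ ha'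
    (event (eq 1) (b (0 : Fin (M + 1)).castSucc).1 (b (0 : Fin (M + 1)).castSucc).2) X0 X1 X2
    (event (ge 0) (z (0 : Fin (M + 1)).castSucc) (w (0 : Fin (M + 1)).castSucc))
    (event (ge 0) (b (0 : Fin (M + 1)).castSucc).2 (w (0 : Fin (M + 1)).succ))
    (event (ge 1) (w (0 : Fin (M + 1)).succ) (t (0 : Fin (M + 1)).castSucc))
    (event (ge 2) (t (0 : Fin (M + 1)).castSucc) (z (0 : Fin (M + 1)).castSucc))
    (event (ge 1) (t (0 : Fin (M + 1)).castSucc) (b (0 : Fin (M + 1)).succ).1)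
    (event (ge 1) (b (0 : Fin (M + 1)).succ).1 (z (0 : Fin (M + 1)).castSucc))
    (isFinitary_event _ _ _) f0 f1 f2 (isFinitary_event _ _ _) (isFinitary_event _ _ _) (isFinitary_event _ _ _)
    (isFinitary_event _ _ _) (isFinitary_event _ _ _) (isFinitary_event _ _ _)
    (singleton_mem_event_eq_one huv) (fun ω K₀ hF => ?_) (hrow₀ _ rfl rfl rfl) ?_ ?_
  · obtain ⟨h0, h1, h2, h3, h4⟩ := hF.conn_midE 0 hσ ha'
    obtain ⟨-, -, hcl⟩ := firstEProper_facts M x b w t z a c τ hF hσ ha ha' hty hc2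
    obtain ⟨-, -, h5⟩ := hF.conn_first
    refine ⟨(hmem₀ ω K₀ hF).1, (hmem₀ ω K₀ hF).2.1, (hmem₀ ω K₀ hF).2.2, ?_, ?_, ?_, ?_, ?_, ?_⟩
    · rw [event_comm, event_ge]; exact mem_openConnGe_zero_of_mem h5
    · rw [event_ge]; exact mem_openConnGe_zero_of_mem h0
    · rw [event_ge]; exact mem_openConnGe_one_of_ne h1 hwt
    · rw [event_ge]
      exact mem_openConnGe_two_of_notMem h2 htz fun hm => hcl (hF.witness_subset _ 2 hm)
    · rw [event_ge]; exact mem_openConnGe_one_of_ne h3 hty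
    · rw [event_comm, event_ge]; exact mem_openConnGe_one_of_ne h4 hzy
  · exact (junF_firstEP_xb_le₅ p M x b w t z a τ hσ ha' _ _ _ _ _ _ _ _ _ _).trans
      (piPerc_genDisjOcc_le_P p (eq 1) (ge 0) (ge 1) (ge 2) (ge 0) _ _ _ _ _ _ _)
  · exact (junF_firstEP_up_le₂ p M x b w t z a τ hσ ha' _ _ _ _ _ _ _ _ _ _).trans
      (piPerc_genDisjOcc_le_B p (ge 1) (ge 1) _ _ _ _)

/-- **Row `(≥2, ≥2 | d ≥ 2)` at the first junction in the literal base-`u_0` coordinates of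
`NobleBlocksNTPrime.blockBNTpt₀'`** (second summand of `blockBNTpt₀'_two_two`), behind `P^{S,2}`.
[cite: FitznerVanDerHofstad2017, App. B Table "B^{(2),ι,a,b}", row a ≥ 2, b ≥ 2, d ≥ 2 (arXiv:1506.07977v2 p. 76); §5.1 (5.4) (p. 48)] -/
theorem nonempty_jPkg_firstE_proper_two_two_lit (κ : Fin d × Bool)
    (hb : (b (0 : Fin (M + 1)).castSucc).2 = (b (0 : Fin (M + 1)).castSucc).1 + stepVec κ) (hσ : (τ 0).1 = true)
    (hc2 : (τ 0).2 = 2) (ha : a (0 : Fin (M + 1)).castSucc = Sum.inl 2) {a' : Fin 3}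
    (ha' : a (0 : Fin (M + 1)).succ = Sum.inl a') (hty : t (0 : Fin (M + 1)).castSucc ≠ (b (0 : Fin (M + 1)).succ).1) :
    Nonempty (JPkg p (jctx M x b w t z a τ (0 : Fin (M + 1)).castSucc) (JFacts M x b w t z a c τ)
      (blockPS (Letters.perc d p) 2 (b (0 : Fin (M + 1)).castSucc).1 (w (0 : Fin (M + 1)).castSucc) *
        ((Letters.perc d p).B (ge 1) (ge 1)
            (((b (0 : Fin (M + 1)).succ).1 - (b (0 : Fin (M + 1)).castSucc).1) -
              (t (0 : Fin (M + 1)).castSucc - (b (0 : Fin (M + 1)).castSucc).1))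
            ((z (0 : Fin (M + 1)).castSucc - (b (0 : Fin (M + 1)).castSucc).1) -
              (t (0 : Fin (M + 1)).castSucc - (b (0 : Fin (M + 1)).castSucc).1)) *
          (Letters.perc d p).P (eq 1) (ge 0) (ge 1) (ge 2) (ge 0) (stepVec κ)
            (w (0 : Fin (M + 1)).succ - (b (0 : Fin (M + 1)).castSucc).1)
            (t (0 : Fin (M + 1)).castSucc - (b (0 : Fin (M + 1)).castSucc).1)
            (z (0 : Fin (M + 1)).castSucc - (b (0 : Fin (M + 1)).castSucc).1)
            (w (0 : Fin (M + 1)).castSucc - (b (0 : Fin (M + 1)).castSucc).1)))) := by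
  have he : (b (0 : Fin (M + 1)).castSucc).2 - (b (0 : Fin (M + 1)).castSucc).1 = stepVec κ := by
    rw [hb, add_sub_cancel_left]
  rw [sub_sub_sub_cancel_right, sub_sub_sub_cancel_right, ← he]
  exact nonempty_jPkg_firstE_proper_two_two p M x b w t z a c τ κ hb hσ hc2 ha ha' hty

/-- **Row `(0, ≥2 | d ≥ 2)` of `B^{(2)}` at the FIRST junction behind `P^{S,0}`**: for `t_0 ≠ u_1` (`F″`), inner
class `2`, start class `0` (`w_0 = u_0`), a package with target
`P^{S,0}(u_0,w_0) · (S_{≥1,≥0,1̲,≥1}(w_1−t_0, b̄_0−t_0, u_0−t_0, z_0−t_0) · T_{≥2,≥1,≥1}(z_0−t_0, u_1−t_0, 0))`;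
`a_1 ≤ 1`: empty piece.
[cite: FitznerVanDerHofstad2017, App. B Table "B^{(2),ι,a,b}", row a = 0, b ≥ 2, d ≥ 2 (arXiv:1506.07977v2 p. 76); §5.1 (5.1), (5.4) (pp. 46–48); §6.1 "Case a = 0" (p. 58)] -/
theorem nonempty_jPkg_firstE_proper_zero_two (κ : Fin d × Bool)
    (hb : (b (0 : Fin (M + 1)).castSucc).2 = (b (0 : Fin (M + 1)).castSucc).1 + stepVec κ) (hσ : (τ 0).1 = true)
    (hc2 : (τ 0).2 = 2) (ha : a (0 : Fin (M + 1)).castSucc = Sum.inl 0) {a' : Fin 3}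
    (ha' : a (0 : Fin (M + 1)).succ = Sum.inl a') (hty : t (0 : Fin (M + 1)).castSucc ≠ (b (0 : Fin (M + 1)).succ).1) :
    Nonempty (JPkg p (jctx M x b w t z a τ (0 : Fin (M + 1)).castSucc) (JFacts M x b w t z a c τ)
      (blockPS (Letters.perc d p) 0 (b (0 : Fin (M + 1)).castSucc).1 (w (0 : Fin (M + 1)).castSucc) *
        ((Letters.perc d p).S (ge 1) (ge 0) (eq 1) (ge 1) (w (0 : Fin (M + 1)).succ - t (0 : Fin (M + 1)).castSucc)
            ((b (0 : Fin (M + 1)).castSucc).2 - t (0 : Fin (M + 1)).castSucc)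
            ((b (0 : Fin (M + 1)).castSucc).1 - t (0 : Fin (M + 1)).castSucc)
            (z (0 : Fin (M + 1)).castSucc - t (0 : Fin (M + 1)).castSucc) *
          (Letters.perc d p).T (ge 2) (ge 1) (ge 1) (z (0 : Fin (M + 1)).castSucc - t (0 : Fin (M + 1)).castSucc)
            ((b (0 : Fin (M + 1)).succ).1 - t (0 : Fin (M + 1)).castSucc) 0))) := by
  -- exit class `a′ ≤ 1` above: the piece is empty (clause (8))
  by_cases h2 : a' = 2
  swap
  · exact nonempty_jPkg_of_sharp p c _ 0 hσ ha' h2 hty _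
  subst h2
  -- degenerate parameters: the piece is empty
  by_cases hP : z (0 : Fin (M + 1)).castSucc ≠ (b (0 : Fin (M + 1)).succ).1 ∧
      w (0 : Fin (M + 1)).succ ≠ t (0 : Fin (M + 1)).castSucc ∧
      t (0 : Fin (M + 1)).castSucc ≠ z (0 : Fin (M + 1)).castSucc ∧
      (b (0 : Fin (M + 1)).castSucc).1 ≠ z (0 : Fin (M + 1)).castSucc ∧
      ((b (0 : Fin (M + 1)).castSucc).1 = 0 → w (0 : Fin (M + 1)).castSucc = 0) ∧
      w (0 : Fin (M + 1)).castSucc = (b (0 : Fin (M + 1)).castSucc).1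
  swap
  · refine ⟨JPkg.vacuous p _ _ (fun ω K₀ hF => hP ?_) _⟩
    obtain ⟨⟨-, hzy, hwt, -, -, huz, -, hcan, hw0, -, -⟩, htz, -⟩ :=
      firstEProper_facts M x b w t z a c τ hF hσ ha ha' hty hc2
    exact ⟨hzy, hwt, htz, huz, hcan, hw0 rfl⟩
  obtain ⟨hzy, hwt, htz, huz, hcan, hwu⟩ := hP
  have huv : (b (0 : Fin (M + 1)).castSucc).1 ≠ (b (0 : Fin (M + 1)).castSucc).2 := by
    rw [hb]; exact (zdGraph_adj_iff_stepVec _ _ |>.2 ⟨κ, rfl⟩).ne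
  obtain ⟨X0, X1, X2, f0, f1, f2, hmem₀, hrow₀⟩ :=
    first_startLetter_gl p M x b w t z a c τ glFirstS3 true false (.lo 0) rfl rfl rfl ha hcan (fun _ => hwu)
      (fun h => absurd h (by decide)) (fun h => absurd h (by decide))
  refine nonempty_jPkg_firstES_core p M x b w t z a c τ hσ ha'
    (event (eq 1) (b (0 : Fin (M + 1)).castSucc).2 (b (0 : Fin (M + 1)).castSucc).1) X0 X1 X2
    (event (ge 1) (b (0 : Fin (M + 1)).castSucc).1 (z (0 : Fin (M + 1)).castSucc))
    (event (ge 0) (w (0 : Fin (M + 1)).succ) (b (0 : Fin (M + 1)).castSucc).2)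
    (event (ge 1) (t (0 : Fin (M + 1)).castSucc) (w (0 : Fin (M + 1)).succ))
    (event (ge 2) (t (0 : Fin (M + 1)).castSucc) (z (0 : Fin (M + 1)).castSucc))
    (event (ge 1) (b (0 : Fin (M + 1)).succ).1 (t (0 : Fin (M + 1)).castSucc))
    (event (ge 1) (z (0 : Fin (M + 1)).castSucc) (b (0 : Fin (M + 1)).succ).1)
    (isFinitary_event _ _ _) f0 f1 f2 (isFinitary_event _ _ _) (isFinitary_event _ _ _) (isFinitary_event _ _ _)
    (isFinitary_event _ _ _) (isFinitary_event _ _ _) (isFinitary_event _ _ _)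
    (by rw [event_comm]; exact singleton_mem_event_eq_one huv) (fun ω K₀ hF => ?_) (hrow₀ _ rfl rfl rfl) ?_ ?_
  · obtain ⟨h0, h1, h2, h3, h4⟩ := hF.conn_midE 0 hσ ha'
    obtain ⟨-, -, hcl⟩ := firstEProper_facts M x b w t z a c τ hF hσ ha ha' hty hc2
    obtain ⟨-, -, h5⟩ := hF.conn_first
    rw [hwu] at h5
    refine ⟨(hmem₀ ω K₀ hF).1, (hmem₀ ω K₀ hF).2.1, (hmem₀ ω K₀ hF).2.2, ?_, ?_, ?_, ?_, ?_, ?_⟩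
    · rw [event_ge]; exact mem_openConnGe_one_of_ne h5 huz
    · rw [event_comm, event_ge]; exact mem_openConnGe_zero_of_mem h0
    · rw [event_comm, event_ge]; exact mem_openConnGe_one_of_ne h1 hwt
    · rw [event_ge]
      exact mem_openConnGe_two_of_notMem h2 htz fun hm => hcl (hF.witness_subset _ 2 hm)
    · rw [event_comm, event_ge]; exact mem_openConnGe_one_of_ne h3 hty
    · rw [event_ge]; exact mem_openConnGe_one_of_ne h4 hzy
  · exact (junF_firstES_xb_le₄ p M x b w t z a τ hσ ha' _ _ _ _ _ _ _ _ _ _).trans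
      (piPerc_genDisjOcc_le_S p (ge 1) (ge 0) (eq 1) (ge 1) _ _ _ _ _ _)
  · refine (junF_firstES_up_le₃ p M x b w t z a τ hσ ha' _ _ _ _ _ _ _ _ _ _).trans ?_
    have hT := piPerc_genDisjOcc_le_T p (ge 2) (ge 1) (ge 1) (t (0 : Fin (M + 1)).castSucc)
      (z (0 : Fin (M + 1)).castSucc) (b (0 : Fin (M + 1)).succ).1 (t (0 : Fin (M + 1)).castSucc)
      (![1, 1, 1] : Fin 3 → Fin 2)
    rwa [sub_self] at hT

/-- **Row `(0, ≥2 | d ≥ 2)` at the first junction in the literal base-`u_0` coordinates of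
`NobleBlocksNTPrime.blockBNTpt₀'`** (second summand of `blockBNTpt₀'_zero_two` with its prefactors), behind `P^{S,0}`.
[cite: FitznerVanDerHofstad2017, App. B Table "B^{(2),ι,a,b}", row a = 0, b ≥ 2, d ≥ 2 (arXiv:1506.07977v2 p. 76); §5.1 (5.4) (p. 48)] -/
theorem nonempty_jPkg_firstE_proper_zero_two_lit (κ : Fin d × Bool)
    (hb : (b (0 : Fin (M + 1)).castSucc).2 = (b (0 : Fin (M + 1)).castSucc).1 + stepVec κ) (hσ : (τ 0).1 = true)
    (hc2 : (τ 0).2 = 2) (ha : a (0 : Fin (M + 1)).castSucc = Sum.inl 0) {a' : Fin 3}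
    (ha' : a (0 : Fin (M + 1)).succ = Sum.inl a') (hty : t (0 : Fin (M + 1)).castSucc ≠ (b (0 : Fin (M + 1)).succ).1) :
    Nonempty (JPkg p (jctx M x b w t z a τ (0 : Fin (M + 1)).castSucc) (JFacts M x b w t z a c τ)
      (blockPS (Letters.perc d p) 0 (b (0 : Fin (M + 1)).castSucc).1 (w (0 : Fin (M + 1)).castSucc) *
        (kd (w (0 : Fin (M + 1)).castSucc - (b (0 : Fin (M + 1)).castSucc).1) 0 *
          (kdc (w (0 : Fin (M + 1)).castSucc - (b (0 : Fin (M + 1)).castSucc).1)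
              (z (0 : Fin (M + 1)).castSucc - (b (0 : Fin (M + 1)).castSucc).1) *
            ((Letters.perc d p).S (ge 1) (ge 0) (eq 1) (ge 1)
                ((w (0 : Fin (M + 1)).succ - (b (0 : Fin (M + 1)).castSucc).1) -
                  (t (0 : Fin (M + 1)).castSucc - (b (0 : Fin (M + 1)).castSucc).1))
                (stepVec κ - (t (0 : Fin (M + 1)).castSucc - (b (0 : Fin (M + 1)).castSucc).1))
                (-(t (0 : Fin (M + 1)).castSucc - (b (0 : Fin (M + 1)).castSucc).1))
                ((z (0 : Fin (M + 1)).castSucc - (b (0 : Fin (M + 1)).castSucc).1) -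
                  (t (0 : Fin (M + 1)).castSucc - (b (0 : Fin (M + 1)).castSucc).1)) *
              (Letters.perc d p).T (ge 2) (ge 1) (ge 1)
                ((z (0 : Fin (M + 1)).castSucc - (b (0 : Fin (M + 1)).castSucc).1) -
                  (t (0 : Fin (M + 1)).castSucc - (b (0 : Fin (M + 1)).castSucc).1))
                (((b (0 : Fin (M + 1)).succ).1 - (b (0 : Fin (M + 1)).castSucc).1) -
                  (t (0 : Fin (M + 1)).castSucc - (b (0 : Fin (M + 1)).castSucc).1)) 0))))) := by
  have he : (b (0 : Fin (M + 1)).castSucc).2 - (b (0 : Fin (M + 1)).castSucc).1 = stepVec κ := by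
    rw [hb, add_sub_cancel_left]
  by_cases hwu : w (0 : Fin (M + 1)).castSucc = (b (0 : Fin (M + 1)).castSucc).1
  swap
  · rw [kd_of_ne (sub_ne_zero.2 hwu), zero_mul, mul_zero]
    exact ⟨JPkg.vacuous p _ _ (fun ω K₀ hF => hwu (hF.w_eq_of_exitClass_zero _ ha)) _⟩
  by_cases huz : (b (0 : Fin (M + 1)).castSucc).1 = z (0 : Fin (M + 1)).castSucc
  · rw [hwu, huz, kdc_self, zero_mul, mul_zero, mul_zero]
    refine ⟨JPkg.vacuous p _ _ (fun ω K₀ hF => ?_) _⟩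
    obtain ⟨⟨-, -, -, -, -, huz', -⟩, -⟩ := firstEProper_facts M x b w t z a c τ hF hσ ha ha' hty hc2
    exact huz' huz
  rw [hwu, sub_self, kd_self, one_mul, kdc_of_ne (fun h => huz (sub_eq_zero.1 h.symm).symm), one_mul,
    sub_sub_sub_cancel_right, sub_sub_sub_cancel_right, sub_sub_sub_cancel_right, ← he,
    sub_sub_sub_cancel_right, neg_sub]
  have h := nonempty_jPkg_firstE_proper_zero_two p M x b w t z a c τ κ hb hσ hc2 ha ha' hty
  rw [hwu] at h
  exact h

end Packages

end Literature.Probability.FitznerVanDerHofstad2017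

end
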